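import Literature.NumberTheory.GaloisCohomology.Howard2004.LevelRaisingNoFixedVectorProofs
import Literature.NumberTheory.GaloisCohomology.Howard2004.DVRKolyvaginBoundProofs
import Literature.NumberTheory.GaloisRepresentations.DiscreteCochainsLongExact
import HarnessLib

/-!
# Howard 2004, Lemma 1.3.3 — the part used by Thm. 1.6.1 — PROVED on a `DVRSetting`:
# `H¹(K, inc_k)` maps `H¹_F(K, T^{(k)})` injectively into `H¹_F(K, T^{(k+1)})` (theorems only)

Topic `NumberTheory/GaloisCohomology/Howard2004` (sequel to `DVRKolyvaginBoundProofs` §H/§I and to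
`LevelRaisingNoFixedVectorProofs`).  THEOREMS ONLY: no definition, no named fact, no instance, no notation,
no `sorry`.

WHY (INPUTS list row G87 = `Howard2004.thm161_dvrKolyvaginBound`, Howard 2004 Thm. 1.6.1; registered stub
`stub_h161` of the shared μ-crux stmt-BirchSwinnertonDyer-22642 `MuInequalityCoherentPair`, binder `h161` of
the print-leaf census of crux 23055; cell `pub/bsd-print-x9`, seat `bsd-line-x10b-p1-w2` g14).  The INPUT seat's
reduction (`DVRKolyvaginBoundProofs.lean`, evidence «needs-X» v3 on 22642) proves conclusions (i) and (iii) of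
Thm. 1.6.1 on a `DVRSetting` MODULO three printed inputs taken as hypotheses: (a) «Lemma 1.3.3, the part
used» = the two hypotheses `hFinc` (`H¹(inc_k)` maps `H¹_F(K, T^{(k)})` into `H¹_F(K, T^{(k+1)})`) and `hFinj`
(injectively), (b) Thm. 1.4.2 + Prop. 1.5.5 with `ε = 1`, (c) Lemma 1.6.4 at `n = 1`.  THIS FILE PROVES (a)
from Hypotheses H.0–H.5 (`DVRSetting.SatisfiesH`) and restates §H/§I without it:

* §1 (generic) `subsingleton_continuousCohomology_zero_of_forall_eq_zero` (`H⁰ = 0` from no invariants);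
  `IsSES.cohomologyMap_one_eq_zero_imp` (`H⁰(M₃) = 0 ⇒ H¹(f)` injective, from the tree's long exact sequence
  `IsSES.exists_connectingHom`);
* §2 (tower) `AdicTower.mem_range_inc_iff`, `range_inc_le_comap`, **`AdicTower.incH1_injective_of_forall_fixed`**
  — `H¹(K, inc_k)` is injective when `inc_k` is and `coker (inc_k)` has no `Γ_K`-fixed vector (the short exact
  sequence `0 → T^{(k)} → T^{(k+1)} → T^{(k+1)}/im (inc_k) → 0` as an `IsSES` for `ContinuousRep.mkQHom`);
* §3 (`DVRSetting` with `SatisfiesH`) `inc_injective` (exact tower + H.0), `ρbar_smul`, **`ρbar_fixed_eq_zero`**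
  (`T̄^{Γ_K} = 0` from H.0 + H.1), `exists_eq_smul_of_forall_sub_eq_smul` (no fixed vector mod `π`),
  `mem_range_inc_of_forall` (`(coker inc_k)^{Γ_K} = 0` by dévissage), and the two halves of the printed input:
  **`DVRSetting.incH1_mem_selmerGroup`** (= `hFinc`) and **`DVRSetting.incH1_injective`** (⊋ `hFinj`: injective on
  all of `H¹(K, T^{(k)})`);
* §4 **`DVRSetting.exists_isFreeRankOneOn_of_levelwiseStructure'`** / `…Structure` /
  **`…_length_le_of_levelwiseStructure`** = §H/§I of `DVRKolyvaginBoundProofs` with (a) DISCHARGED: Thm. 1.6.1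
  (i), resp. (i)+(iii), MODULO ONLY (b) [and (c), `κ_1 ≠ 0`].

Print: Howard, Compositio Math. 140 (2004) = arXiv:1202.6340: Lemma 1.3.3 (arXiv Lemma 2.3.3, p. 7 L152–160; =
Mazur–Rubin 2004 Lemma 3.5.4), H.0/H.1 (p. 7 L57–59), §1.6 (p. 11 L13–20; proof of Thm. 1.6.1, p. 12 L36–46: «by the
injectivity of `H¹_F(K,T)/𝔪^k H¹_F(K,T) → H¹_F(K, T^{(k)})`»).  HONEST FRAMING: `thm161_dvrKolyvaginBound` is NOT
proved (conclusion (ii), inputs (b), (c) and the glue remain); no summit statement is proved; the Birch–Swinnerton-Dyer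
conjecture is not proved by any of this.  References: [Howard2004HeegnerKolyvagin] Compositio Math. 140 (2004),
Lemma 1.3.3, §1.3, §1.6; [MazurRubinMemoirs2004] Mem. AMS 799, Lemma 3.5.4; [SerreGaloisCohomology1997] I §2.2;
[Shatz1972] Ch. II §1 Prop. 3.
-/

set_option autoImplicit false

noncomputable section

open Function NumberField IsDedekindDomain Field
open scoped NumberField ContRepresentation Pointwise

namespace Literature.NumberTheory.GaloisCohomology.Howard2004

open Literature.NumberTheory.GaloisCohomology.Howard2004.LevelRaising

/-! ## §1 Generic: `H⁰ = 0` from no invariants; `H¹(f)` injective when `H⁰` of the cokernel vanishes -/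

section TowerSES

open CategoryTheory
open _root_.TopRep _root_.ContRepresentation _root_.ContinuousCohomology
open Literature.NumberTheory.GaloisRepresentations
open Literature.NumberTheory.GaloisRepresentations.DiscreteGaloisModule

universe u

set_option allowUnsafeReducibility true in
attribute [local reducible] CategoryTheory.Functor.mapHomologicalComplex

/-- **`H⁰(Γ, M) = 0` when `M` has no non-zero `Γ`-fixed vector** (Mathlib `ContinuousCohomology.zeroIso`:
`H⁰ ≅ M^Γ`). [cite: SerreGaloisCohomology1997, I §2.2] [cite: Shatz1972, Ch. II §1 Prop. 3] -/
theorem subsingleton_continuousCohomology_zero_of_forall_eq_zero {A : Type*} [CommRing A]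
    [TopologicalSpace A] {Γ : Type u} [Group Γ] [TopologicalSpace Γ] [IsTopologicalGroup Γ]
    {M : Type u} [AddCommGroup M] [Module A M] [TopologicalSpace M] [DiscreteTopology M]
    [ContinuousSMul A M] (ρ : ContinuousRep Γ A M)
    (h : ∀ x : M, (∀ g : Γ, ρ g x = x) → x = 0) :
    Subsingleton (continuousCohomology 0 ρ.toTopRep) := by
  have e := (ContinuousCohomology.zeroIso ρ.toTopRep).toContinuousLinearEquiv.toLinearEquiv.toEquiv
  haveI : Subsingleton (ρ.toTopRep.ρ.invariants) := by
    refine ⟨fun a b => Subtype.ext ?_⟩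
    have ha := h a.1 (fun g => (ContRepresentation.mem_invariants _).1 a.2 g)
    have hb := h b.1 (fun g => (ContRepresentation.mem_invariants _).1 b.2 g)
    rw [ha, hb]
  exact e.subsingleton

/-- **`H¹(f)` is injective for a short exact sequence `0 → M₁ →(f) M₂ →(g) M₃ → 0` of discrete modules over a
compact group with `H⁰(Γ, M₃) = 0`** (exactness `H⁰(M₃) →(δ) H¹(M₁) →(H¹ f) H¹(M₂)`, tree
`IsSES.exists_connectingHom`). [cite: SerreGaloisCohomology1997, I §2.2] [cite: Shatz1972, Ch. II §1 Prop. 3] -/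
theorem _root_.Literature.NumberTheory.GaloisRepresentations.IsSES.cohomologyMap_one_eq_zero_imp {A : Type*} [CommRing A] [TopologicalSpace A]
    {Γ : Type u} [Group Γ] [TopologicalSpace Γ] [IsTopologicalGroup Γ] [CompactSpace Γ]
    {M₁ : Type u} [AddCommGroup M₁] [Module A M₁] [TopologicalSpace M₁] [DiscreteTopology M₁]
    [ContinuousSMul A M₁]
    {M₂ : Type u} [AddCommGroup M₂] [Module A M₂] [TopologicalSpace M₂] [DiscreteTopology M₂]
    [ContinuousSMul A M₂]
    {M₃ : Type u} [AddCommGroup M₃] [Module A M₃] [TopologicalSpace M₃] [DiscreteTopology M₃]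
    [ContinuousSMul A M₃]
    {ρ₁ : ContinuousRep Γ A M₁} {ρ₂ : ContinuousRep Γ A M₂} {ρ₃ : ContinuousRep Γ A M₃}
    {f : ρ₁.toTopRep ⟶ ρ₂.toTopRep} {g : ρ₂.toTopRep ⟶ ρ₃.toTopRep} (h : IsSES f g)
    (h0 : Subsingleton (continuousCohomology 0 ρ₃.toTopRep))
    (c : continuousCohomology 1 ρ₁.toTopRep) (hc : cohomologyMap f 1 c = 0) : c = 0 := by
  obtain ⟨δ, h1, -, -, -⟩ := h.exists_connectingHom 0
  obtain ⟨γ, hγ⟩ := h1 c hc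
  rw [Subsingleton.elim γ 0, map_zero] at hγ
  exact hγ.symm

end TowerSES

/-! ## §2 The tower: `H¹(K, inc_k)` is injective when `inc_k` is and `coker (inc_k)` has no invariants -/

namespace AdicTower

open CategoryTheory
open Literature.NumberTheory.GaloisRepresentations
open Literature.NumberTheory.GaloisRepresentations.DiscreteGaloisModule

variable {K : Type} [Field K] [NumberField K] {R : Type} [CommRing R] [IsLocalRing R]
  {N : ℕ → Type} [∀ k, AddCommGroup (N k)] [∀ k, TopologicalSpace (N k)] [∀ k, DiscreteTopology (N k)]
  [∀ k, Module R (N k)]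
  (T : AdicTower K R N) (π : R) (e : ℕ → ℕ)
  (hkill : ∀ k, ∀ r ∈ IsLocalRing.maximalIdeal R ^ e k, ∀ x : N k, r • x = 0)
  (hker : ∀ k, LinearMap.ker (T.red k) = (IsLocalRing.maximalIdeal R ^ e k) • (⊤ : Submodule R (N (k + 1))))
  (hπ : π ∈ IsLocalRing.maximalIdeal R) (he : ∀ k, e k ≤ e (k + 1))

omit [NumberField K] in
/-- **`im (inc_k) = π^{e_{k+1}-e_k} · T^{(k+1)}`** (`inc_k ∘ red_k = π^{e_{k+1}-e_k}`, `red_k` onto). [cite: Howard2004HeegnerKolyvagin, Lemma 1.3.3 and §1.6 (arXiv p. 7 L152–160, p. 11 L18–20, p. 12 L36–46)] -/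
theorem mem_range_inc_iff (k : ℕ) (z : N (k + 1)) :
    z ∈ LinearMap.range (inc T π e hkill hker hπ he k) ↔ ∃ w, z = π ^ (e (k + 1) - e k) • w := by
  constructor
  · rintro ⟨x, rfl⟩
    obtain ⟨w, rfl⟩ := T.red_surjective k x
    exact ⟨w, inc_red T π e hkill hker hπ he k w⟩
  · rintro ⟨w, rfl⟩
    exact ⟨T.red k w, inc_red T π e hkill hker hπ he k w⟩

omit [NumberField K] in
/-- `im (inc_k)` is a `Γ_K`-stable subgroup of `T^{(k+1)}` (`inc_k` is equivariant). [cite: Howard2004HeegnerKolyvagin, Lemma 1.3.3 and §1.6 (arXiv p. 7 L152–160, p. 11 L18–20, p. 12 L36–46)] -/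
theorem range_inc_le_comap (k : ℕ) (g : absoluteGaloisGroup K) :
    (LinearMap.range (inc T π e hkill hker hπ he k)).restrictScalars ℤ ≤
      ((LinearMap.range (inc T π e hkill hker hπ he k)).restrictScalars ℤ).comap (T.ρ (k + 1) g) := by
  rintro _ ⟨x, rfl⟩
  exact ⟨T.ρ k g x, inc_equivariant T π e hkill hker hπ he k g x⟩

set_option allowUnsafeReducibility true in
attribute [local reducible] CategoryTheory.Functor.mapHomologicalComplex

/-- **`H¹(K, inc_k) : H¹(K, T^{(k)}) → H¹(K, T^{(k+1)})` is injective as soon as `inc_k` is injective and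
`coker (inc_k) = T^{(k+1)}/im (inc_k)` has no non-zero `Γ_K`-fixed vector** — the long exact sequence of
`0 → T^{(k)} →(inc_k) T^{(k+1)} → T^{(k+1)}/im (inc_k) → 0` (tree `IsSES`, `ContinuousRep.mkQHom`,
`ContinuousRep.quotient`) in degrees `0 → 1`.  The tower-level form of the injectivity in Howard's
Lemma 1.3.3 / Mazur–Rubin's Lemma 3.5.4, with its two inputs left as hypotheses. [cite: Howard2004HeegnerKolyvagin, Lemma 1.3.3 and §1.6 (arXiv p. 7 L152–160, p. 11 L18–20, p. 12 L36–46)] [cite: SerreGaloisCohomology1997, I §2.2] [cite: Shatz1972, Ch. II §1 Prop. 3] -/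
theorem incH1_injective_of_forall_fixed (k : ℕ)
    (hinj : Function.Injective (inc T π e hkill hker hπ he k))
    (hfix : ∀ z : N (k + 1), (∀ g : absoluteGaloisGroup K,
        T.ρ (k + 1) g z - z ∈ LinearMap.range (inc T π e hkill hker hπ he k)) →
      z ∈ LinearMap.range (inc T π e hkill hker hπ he k)) :
    Function.Injective (incH1 T π e hkill hker hπ he k) := by
  refine (injective_iff_map_eq_zero _).2 fun c hc => ?_
  set W : Submodule ℤ (N (k + 1)) := (LinearMap.range (inc T π e hkill hker hπ he k)).restrictScalars ℤ
  have hW : ∀ g, W ≤ W.comap (T.ρ (k + 1) g) := range_inc_le_comap T π e hkill hker hπ he k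
  let f : (T.ρ k).toTopRep ⟶ (T.ρ (k + 1)).toTopRep :=
    TopRep.ofHom ⟨⟨(inc T π e hkill hker hπ he k).toAddMonoidHom.toIntLinearMap,
      continuous_of_discreteTopology⟩,
      fun g => ContinuousLinearMap.ext fun x => inc_equivariant T π e hkill hker hπ he k g x⟩
  have hSES : IsSES f ((T.ρ (k + 1)).mkQHom W hW) :=
    { comp_eq_zero := by
        ext x
        change Submodule.Quotient.mk (p := W) (inc T π e hkill hker hπ he k x) = 0
        exact (Submodule.Quotient.mk_eq_zero W).2 ⟨x, rfl⟩
      injective := fun a b h => hinj h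
      exact_mid := fun y hy => (Submodule.Quotient.mk_eq_zero W).1 hy
      surjective := Submodule.Quotient.mk_surjective W }
  have h0 : Subsingleton (continuousCohomology 0 ((T.ρ (k + 1)).quotient W hW).toTopRep) :=
    subsingleton_continuousCohomology_zero_of_forall_eq_zero _ fun q hq => by
      induction q using Submodule.Quotient.induction_on with
      | _ z =>
        exact (Submodule.Quotient.mk_eq_zero W).2
          (hfix z fun g => (Submodule.Quotient.eq W).1 (hq g))
  have hc' : cohomologyMap f 1 c = 0 := hc
  exact hSES.cohomologyMap_one_eq_zero_imp h0 c hc'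

end AdicTower

/-! ## §3 On a `DVRSetting` with H.0–H.5: both hypotheses of the «Lemma 1.3.3 part» DISCHARGED -/

namespace DVRSetting

open Literature.NumberTheory.GaloisRepresentations
open Literature.NumberTheory.GaloisRepresentations.DiscreteGaloisModule

variable {p : ℕ} [Fact p.Prime] {K : Type} [Field K] [NumberField K]
  {R : Type} [CommRing R] [IsDomain R] [IsDiscreteValuationRing R] [Algebra ℤ_[p] R]
  {N : ℕ → Type} [∀ k, AddCommGroup (N k)] [∀ k, TopologicalSpace (N k)]
  [∀ k, DiscreteTopology (N k)] [∀ k, Module R (N k)]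
  {Rk : ℕ → Type} [∀ k, CommRing (Rk k)] [∀ k, IsLocalRing (Rk k)] [∀ k, TopologicalSpace (Rk k)]
  [∀ k, DiscreteTopology (Rk k)] [∀ k, Algebra ℤ_[p] (Rk k)] [∀ k, Algebra R (Rk k)]
  [∀ k, Module (Rk k) (N k)] [∀ k, IsScalarTower R (Rk k) (N k)]
  {Nbar : Type} [AddCommGroup Nbar] [TopologicalSpace Nbar] [DiscreteTopology Nbar]
  [∀ k, Module (Rk k) Nbar]
  {Nq : ℕ → Finset (HeightOneSpectrum (𝓞 K)) → Type} [∀ k n, AddCommGroup (Nq k n)]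
  [∀ k n, TopologicalSpace (Nq k n)] [∀ k n, DiscreteTopology (Nq k n)]
  [∀ k n, Module (Rk k) (Nq k n)] [∀ k n, Module R (Nq k n)]
  [∀ k n, IsScalarTower R (Rk k) (Nq k n)]

/-- The uniformizer is non-zero (`R` is not a field). [cite: Howard2004HeegnerKolyvagin, §1.3 H.0–H.1 and §1.6 (arXiv p. 7 L57–59, p. 11 L13–20)] -/
theorem π_ne_zero (S : DVRSetting p K R N Rk Nbar Nq) (hy : S.SatisfiesH) : S.π ≠ 0 := fun h =>
  IsDiscreteValuationRing.not_a_field R (by rw [hy.unif, h, Ideal.span_singleton_eq_bot])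

/-- `ker (R → R_j) = 𝔪^{e_j} = (π^{e_j})`. [cite: Howard2004HeegnerKolyvagin, §1.3 H.0–H.1 and §1.6 (arXiv p. 7 L57–59, p. 11 L13–20)] -/
theorem ker_algebraMap_le (S : DVRSetting p K R N Rk Nbar Nq) (hy : S.SatisfiesH) (j : ℕ) :
    RingHom.ker (algebraMap R (Rk j)) ≤ Ideal.span {S.π ^ S.e j} := by
  rw [hy.ker_algebraMap, hy.unif, Ideal.span_singleton_pow]

/-- **`ker (π^i ·) ⊆ π T^{(j)}` below the level** (`i < e_j`; H.0: `T^{(j)}` free over `R_j = R/(π^{e_j})`). [cite: Howard2004HeegnerKolyvagin, §1.3 H.0–H.1 and §1.6 (arXiv p. 7 L57–59, p. 11 L13–20)] -/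
theorem exists_eq_smul_of_pow_smul_eq_zero (S : DVRSetting p K R N Rk Nbar Nq) (hy : S.SatisfiesH)
    (j : ℕ) {i : ℕ} (hi : i < S.e j) (v : N j) (hv : S.π ^ i • v = 0) : ∃ v', v = S.π • v' := by
  haveI := (hy.h0 j).1
  obtain ⟨v'', hv''⟩ := exists_eq_pow_smul_of_pow_smul_eq_zero S.π (S.π_ne_zero hy) (S.e j)
    (hy.algebraMap_surjective j) (S.ker_algebraMap_le hy j) hi.le v hv
  obtain ⟨m, hm⟩ := Nat.exists_eq_succ_of_ne_zero (Nat.sub_ne_zero_of_lt hi)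
  exact ⟨S.π ^ m • v'', by rw [hv'', hm, pow_succ', mul_smul]⟩

/-- **`inc_k : T^{(k)} → T^{(k+1)}` is injective**: `inc_k (red_k y) = π^{e_{k+1}-e_k} y = 0` forces
`y ∈ π^{e_k} T^{(k+1)} = ker (red_k)` (H.0 on level `k+1`, exact tower). [cite: Howard2004HeegnerKolyvagin, Lemma 1.3.3 and §1.6 (arXiv p. 7 L152–160, p. 11 L18–20, p. 12 L36–46)] -/
theorem inc_injective (S : DVRSetting p K R N Rk Nbar Nq) (hy : S.SatisfiesH)
    (hπm : S.π ∈ IsLocalRing.maximalIdeal R) (hle : ∀ k, S.e k ≤ S.e (k + 1)) (k : ℕ) :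
    Function.Injective (AdicTower.inc S.T S.π S.e hy.killed hy.ker_red hπm hle k) := by
  haveI := (hy.h0 (k + 1)).1
  refine (injective_iff_map_eq_zero _).2 fun x hx => ?_
  obtain ⟨y, rfl⟩ := S.T.red_surjective k x
  rw [AdicTower.inc_red] at hx
  obtain ⟨y', rfl⟩ := exists_eq_pow_smul_of_pow_smul_eq_zero S.π (S.π_ne_zero hy) (S.e (k + 1))
    (hy.algebraMap_surjective (k + 1)) (S.ker_algebraMap_le hy (k + 1)) (Nat.sub_le _ _) y hx
  rw [Nat.sub_sub_self (hle k), map_smul]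
  exact hy.killed k _ (Ideal.pow_mem_pow hπm _) _

/-- The residual action `Γ_K → End(T̄)` is `R_j`-linear (H.1 presentation `T^{(j)} ↠ T̄` + `R_j`-linearity of
the action on `T^{(j)}`). [cite: Howard2004HeegnerKolyvagin, §1.3 H.0–H.1 and §1.6 (arXiv p. 7 L57–59, p. 11 L13–20)] -/
theorem ρbar_smul (S : DVRSetting p K R N Rk Nbar Nq) (hy : S.SatisfiesH) (j : ℕ)
    (σ : absoluteGaloisGroup K) (a : Rk j) (x : Nbar) : S.ρbar σ (a • x) = a • S.ρbar σ x := by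
  obtain ⟨hq, -, -, -⟩ := hy.h1 j
  obtain ⟨m, rfl⟩ := hq.surjective x
  rw [← (S.πbar j).map_smul, ← hq.equivariant, hy.scalarLinear j σ a m, map_smul, hq.equivariant]

/-- **`T̄^{Γ_K} = 0` on a `DVRSetting` with H.0–H.5**: `T^{(j)}` is free of rank two over `R_j` (H.0) and
`T̄ = T^{(j)}/𝔪 T^{(j)}` has no proper non-zero stable submodule (H.1), so no non-zero vector of `T̄` is fixed
by `Γ_K` (`LevelRaising.residual_fixed_eq_zero`). [cite: Howard2004HeegnerKolyvagin, §1.3 H.0–H.1 and §1.6 (arXiv p. 7 L57–59, p. 11 L13–20)] -/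
theorem ρbar_fixed_eq_zero (S : DVRSetting p K R N Rk Nbar Nq) (hy : S.SatisfiesH) (j : ℕ)
    (x : Nbar) (hx : ∀ σ : absoluteGaloisGroup K, S.ρbar σ x = x) : x = 0 := by
  obtain ⟨hq, hirr, -, -⟩ := hy.h1 j
  haveI := (hy.h0 j).1
  exact residual_fixed_eq_zero (hy.h0 j).2 (S.πbar j) hq.surjective hq.ker_eq
    (fun σ x => S.ρbar σ x) (fun σ a x => S.ρbar_smul hy j σ a x)
    (fun W hW => hirr W fun σ x hx => hW σ x hx) x hx

/-- The uniformizer lies in `𝔪`. [cite: Howard2004HeegnerKolyvagin, §1.3 H.0–H.1 and §1.6 (arXiv p. 7 L57–59, p. 11 L13–20)] -/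
theorem π_mem_maximalIdeal (S : DVRSetting p K R N Rk Nbar Nq) (hy : S.SatisfiesH) :
    S.π ∈ IsLocalRing.maximalIdeal R := by
  rw [hy.unif]; exact Ideal.mem_span_singleton_self _

/-- **No `Γ_K`-fixed vector modulo `π`**: if `σ y ≡ y (mod π T^{(j)})` for every `σ ∈ Γ_K` then
`y ∈ π T^{(j)}` — the image of `y` in `T̄` is fixed, hence `0` (`ρbar_fixed_eq_zero`), so `y ∈ 𝔪_{R_j} T^{(j)} =
π T^{(j)}`. [cite: Howard2004HeegnerKolyvagin, §1.3 H.0–H.1 and §1.6 (arXiv p. 7 L57–59, p. 11 L13–20)] -/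
theorem exists_eq_smul_of_forall_sub_eq_smul (S : DVRSetting p K R N Rk Nbar Nq) (hy : S.SatisfiesH)
    (j : ℕ) (y : N j) (h : ∀ σ : absoluteGaloisGroup K, ∃ z, S.T.ρ j σ y - y = S.π • z) :
    ∃ y', y = S.π • y' := by
  obtain ⟨hq, -, -, -⟩ := hy.h1 j
  have hϖ : algebraMap R (Rk j) S.π ∈ IsLocalRing.maximalIdeal (Rk j) :=
    (IsLocalRing.mem_maximalIdeal _).2 (algebraMap_mem_nonunits S.π (S.e j)
      (by rw [hy.ker_algebraMap]; exact Ideal.pow_mem_pow (S.π_mem_maximalIdeal hy) _))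
  have hfix : ∀ σ : absoluteGaloisGroup K, S.ρbar σ (S.πbar j y) = S.πbar j y := fun σ => by
    obtain ⟨z, hz⟩ := h σ
    have hmem : S.π • z ∈ LinearMap.ker (S.πbar j) := by
      rw [hq.ker_eq, ← algebraMap_smul (Rk j) S.π z]
      exact Submodule.smul_mem_smul hϖ Submodule.mem_top
    rw [← hq.equivariant, ← sub_eq_zero, ← map_sub, hz]
    exact LinearMap.mem_ker.1 hmem
  have h0 : S.πbar j y = 0 := S.ρbar_fixed_eq_zero hy j _ hfix
  have hy' : y ∈ (IsLocalRing.maximalIdeal (Rk j)) • (⊤ : Submodule (Rk j) (N j)) := by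
    rw [← hq.ker_eq, LinearMap.mem_ker, h0]
  refine exists_eq_smul_of_mem_maximalIdeal_smul S.π (hy.algebraMap_surjective j) (fun r hr => ?_) hy'
  exact Ideal.mem_span_singleton.1 (hy.unif ▸ (IsLocalRing.mem_maximalIdeal r).2 hr)

/-- **`(coker inc_k)^{Γ_K} = 0`**: if `σ z ≡ z (mod im (inc_k))` for every `σ` then `z ∈ im (inc_k) =
π^{e_{k+1}-e_k} T^{(k+1)}` — dévissage (`LevelRaising.exists_eq_pow_smul_of_forall_sub_eq_pow_smul`) from the
residual case and `ker (π^i ·) ⊆ π T^{(k+1)}`. [cite: Howard2004HeegnerKolyvagin, Lemma 1.3.3 and §1.6 (arXiv p. 7 L152–160, p. 11 L18–20, p. 12 L36–46)] -/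
theorem mem_range_inc_of_forall (S : DVRSetting p K R N Rk Nbar Nq) (hy : S.SatisfiesH)
    (hπm : S.π ∈ IsLocalRing.maximalIdeal R) (hle : ∀ k, S.e k ≤ S.e (k + 1)) (k : ℕ)
    (z : N (k + 1)) (hz : ∀ g : absoluteGaloisGroup K, S.T.ρ (k + 1) g z - z ∈
      LinearMap.range (AdicTower.inc S.T S.π S.e hy.killed hy.ker_red hπm hle k)) :
    z ∈ LinearMap.range (AdicTower.inc S.T S.π S.e hy.killed hy.ker_red hπm hle k) := by
  rw [AdicTower.mem_range_inc_iff]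
  refine exists_eq_pow_smul_of_forall_sub_eq_pow_smul S.π (fun σ x => S.T.ρ (k + 1) σ x)
    (fun σ r v => S.T.hlin (k + 1) σ r v) (S.exists_eq_smul_of_forall_sub_eq_smul hy (k + 1))
    (S.e (k + 1)) (fun i hi v hv => S.exists_eq_smul_of_pow_smul_eq_zero hy (k + 1) hi v hv)
    _ (Nat.sub_le _ _) z fun g => ?_
  exact (AdicTower.mem_range_inc_iff S.T S.π S.e hy.killed hy.ker_red hπm hle k _).1 (hz g)

/-- **Lemma 1.3.3, the part used by Thm. 1.6.1 — second half: `H¹(K, inc_k) : H¹(K, T^{(k)}) → H¹(K, T^{(k+1)})`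
is INJECTIVE on a `DVRSetting` satisfying H.0–H.5** (on all of `H¹(K, T^{(k)})`, not only on Selmer classes):
`inc_k` is injective and `coker (inc_k)` has no `Γ_K`-invariants, so the long exact sequence applies.  This
DISCHARGES the hypothesis `hFinj` of `DVRSetting.exists_isFreeRankOneOn_of_printedInputs'` /
`…_length_le_of_printedInputs` («the injectivity of `H¹_F(K,T)/𝔪^k H¹_F(K,T) → H¹_F(K, T^{(k)})`»,
arXiv p. 12 L44–46, there attributed to Lemma 1.3.3). [cite: Howard2004HeegnerKolyvagin, Lemma 1.3.3 and §1.6 (arXiv p. 7 L152–160, p. 11 L18–20, p. 12 L36–46)] [cite: MazurRubinMemoirs2004, Lemma 3.5.4] -/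
theorem incH1_injective (S : DVRSetting p K R N Rk Nbar Nq) (hy : S.SatisfiesH)
    (hπm : S.π ∈ IsLocalRing.maximalIdeal R) (hle : ∀ k, S.e k ≤ S.e (k + 1)) (k : ℕ) :
    Function.Injective (S.T.incH1 S.π S.e hy.killed hy.ker_red hπm hle k) :=
  AdicTower.incH1_injective_of_forall_fixed S.T S.π S.e hy.killed hy.ker_red hπm hle k
    (S.inc_injective hy hπm hle k) (S.mem_range_inc_of_forall hy hπm hle k)

/-- **Lemma 1.3.3, the part used by Thm. 1.6.1 — first half: `H¹(K, inc_k)` maps `H¹_F(K, T^{(k)})` into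
`H¹_F(K, T^{(k+1)})`** on a `DVRSetting` satisfying H.0–H.5: localisation commutes with `H¹(inc_k)`
(`AdicTower.localization_incH1`) and `H¹(K_v, inc_k)` carries `F_{k,v} = red(F_{k+1,v})` into `F_{k+1,v}`
(`DVRSetting.map_incLoc_cond_le`: `inc ∘ red = π^{e_{k+1}-e_k}`, the conditions are `R`-submodules).  This
DISCHARGES the hypothesis `hFinc` of `DVRSetting.exists_isFreeRankOneOn_of_printedInputs'`. [cite: Howard2004HeegnerKolyvagin, Lemma 1.3.3 and §1.6 (arXiv p. 7 L152–160, p. 11 L18–20, p. 12 L36–46)] -/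
theorem incH1_mem_selmerGroup (S : DVRSetting p K R N Rk Nbar Nq) (hy : S.SatisfiesH)
    (hπm : S.π ∈ IsLocalRing.maximalIdeal R) (hle : ∀ k, S.e k ≤ S.e (k + 1)) (k : ℕ)
    {y : galoisCohomology (S.T.ρ k) 1} (hy' : y ∈ ((S.t k).cond).selmerGroup) :
    S.T.incH1 S.π S.e hy.killed hy.ker_red hπm hle k y ∈ ((S.t (k + 1)).cond).selmerGroup := by
  rw [SelmerStructure.mem_selmerGroup_iff] at hy' ⊢
  intro v
  rw [AdicTower.localization_incH1]
  exact S.map_incLoc_cond_le hy hπm hle k v ⟨_, hy' v, rfl⟩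

/-- The exponents increase. [cite: Howard2004HeegnerKolyvagin, §1.3 H.0–H.1 and §1.6 (arXiv p. 7 L57–59, p. 11 L13–20)] -/
theorem e_le_succ (S : DVRSetting p K R N Rk Nbar Nq) (hy : S.SatisfiesH) (k : ℕ) : S.e k ≤ S.e (k + 1) :=
  (hy.e_strictMono (Nat.lt_succ_self k)).le

/-! ## §4 Thm. 1.6.1, conclusions (i) and (i)+(iii), MODULO ONLY Thm. 1.4.2/Prop. 1.5.5 (`ε = 1`) [and Lemma 1.6.4 at `n = 1`] -/

/-- **Thm. 1.6.1, conclusion (i) «`H¹_F(K, T)` is a free rank-one `R`-module», with the levelwise annihilators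
`ann(x_k) = 𝔪^{e_k}`, MODULO ONLY the levelwise structure Thm. 1.4.2 + Prop. 1.5.5 with `ε = 1`** (additive
`R`-equivariant `H¹_F(K, T^{(k)}) ≅ R/𝔪^{e_k} ⊕ M_k ⊕ M_k`, the `M_k` killed by a fixed `π^c`): the «Lemma 1.3.3
part» of `DVRSetting.exists_isFreeRankOneOn_of_printedInputs'` is DISCHARGED by `incH1_mem_selmerGroup` and
`incH1_injective`, and `π ∈ 𝔪`, `e_k ≤ e_{k+1}` by `SatisfiesH`.  `thm161_dvrKolyvaginBound` is NOT proved here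
(conclusion (ii) and the remaining printed inputs stand). [cite: Howard2004HeegnerKolyvagin, Thm. 1.6.1, proof (arXiv p. 12, L29–55)] -/
theorem exists_isFreeRankOneOn_of_levelwiseStructure' (S : DVRSetting p K R N Rk Nbar Nq)
    (hy : S.SatisfiesH)
    {M : ℕ → Type} [∀ k, AddCommGroup (M k)] [∀ k, Module R (M k)] (c : ℕ)
    (hM : ∀ k (m : M k), S.π ^ c • m = 0)
    (θ : ∀ k, ↥(((S.t k).cond).selmerGroup) ≃+ (R ⧸ IsLocalRing.maximalIdeal R ^ S.e k) × (M k × M k))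
    (hθ : ∀ k (r : R) (y : galoisCohomology (S.T.ρ k) 1) (hy' : y ∈ ((S.t k).cond).selmerGroup),
      θ k ⟨galoisCohomology.scalarMapH1 (S.T.ρ k) (S.T.hlin k) r y,
          S.scalarMapH1_mem_selmerGroup hy k r hy'⟩ = r • θ k ⟨y, hy'⟩) :
    ∃ x : ∀ k, galoisCohomology (S.T.ρ k) 1,
      S.T.IsFreeRankOneOn (S.T.limitSelmer fun k => (S.t k).cond) x ∧
      ∀ k, ∀ r : R, galoisCohomology.scalarMapH1 (S.T.ρ k) (S.T.hlin k) r (x k) = 0 ↔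
        r ∈ IsLocalRing.maximalIdeal R ^ S.e k :=
  S.exists_isFreeRankOneOn_of_printedInputs' hy (S.π_mem_maximalIdeal hy) (S.e_le_succ hy)
    (fun k _ hy' => S.incH1_mem_selmerGroup hy _ _ k hy')
    (fun k y _ h => S.incH1_injective hy _ _ k (by rw [h, map_zero])) c hM θ hθ

/-- **Thm. 1.6.1, conclusion (i) «`H¹_F(K, T)` is a free rank-one `R`-module», MODULO ONLY Thm. 1.4.2 +
Prop. 1.5.5 with `ε = 1`** (`exists_isFreeRankOneOn_of_levelwiseStructure'` without the annihilators). [cite: Howard2004HeegnerKolyvagin, Thm. 1.6.1, proof (arXiv p. 12, L29–55)] -/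
theorem exists_isFreeRankOneOn_of_levelwiseStructure (S : DVRSetting p K R N Rk Nbar Nq)
    (hy : S.SatisfiesH)
    {M : ℕ → Type} [∀ k, AddCommGroup (M k)] [∀ k, Module R (M k)] (c : ℕ)
    (hM : ∀ k (m : M k), S.π ^ c • m = 0)
    (θ : ∀ k, ↥(((S.t k).cond).selmerGroup) ≃+ (R ⧸ IsLocalRing.maximalIdeal R ^ S.e k) × (M k × M k))
    (hθ : ∀ k (r : R) (y : galoisCohomology (S.T.ρ k) 1) (hy' : y ∈ ((S.t k).cond).selmerGroup),
      θ k ⟨galoisCohomology.scalarMapH1 (S.T.ρ k) (S.T.hlin k) r y,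
          S.scalarMapH1_mem_selmerGroup hy k r hy'⟩ = r • θ k ⟨y, hy'⟩) :
    ∃ x : ∀ k, galoisCohomology (S.T.ρ k) 1,
      S.T.IsFreeRankOneOn (S.T.limitSelmer fun k => (S.t k).cond) x := by
  obtain ⟨x, hx, -⟩ := S.exists_isFreeRankOneOn_of_levelwiseStructure' hy c hM θ hθ
  exact ⟨x, hx⟩

/-- **Thm. 1.6.1, conclusions (i) and (iii) together — `H¹_F(K, T)` free of rank one AND, for `k ≫ 0` and every
`r₁` with `κ_1 = r₁ · x`, `len_R M_k ≤ len_R (R/r₁R)` — MODULO ONLY Thm. 1.4.2/Prop. 1.5.5 (`ε = 1`, finite `M_k`)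
and Lemma 1.6.4 at `n = 1`** (`κ_1^{(k)} ∈ 𝔪^{len M_k} H¹_F(K, T^{(k)})`), for a Kolyvagin system with `κ_1 ≠ 0`:
`DVRSetting.exists_isFreeRankOneOn_length_le_of_printedInputs` with its «Lemma 1.3.3 part» (`hFinc`, `hFinj`)
DISCHARGED.  After this file the tree's reduction of `thm161_dvrKolyvaginBound` rests on TWO printed inputs
(Thm. 1.4.2/Prop. 1.5.5; Lemma 1.6.4 at `n = 1`) plus conclusion (ii) and the glue; the fact itself is NOT proved. [cite: Howard2004HeegnerKolyvagin, Thm. 1.6.1, proof (arXiv p. 12, L29–55)] -/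
theorem exists_isFreeRankOneOn_length_le_of_levelwiseStructure (S : DVRSetting p K R N Rk Nbar Nq)
    (κ : S.KolyvaginSystem) (hy : S.SatisfiesH)
    {M : ℕ → Type} [∀ k, AddCommGroup (M k)] [∀ k, Module R (M k)] [∀ k, Finite (M k)] (c : ℕ)
    (hM : ∀ k (m : M k), S.π ^ c • m = 0)
    (θ : ∀ k, ↥(((S.t k).cond).selmerGroup) ≃+ (R ⧸ IsLocalRing.maximalIdeal R ^ S.e k) × (M k × M k))
    (hθ : ∀ k (r : R) (y : galoisCohomology (S.T.ρ k) 1) (hy' : y ∈ ((S.t k).cond).selmerGroup),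
      θ k ⟨galoisCohomology.scalarMapH1 (S.T.ρ k) (S.T.hlin k) r y,
          S.scalarMapH1_mem_selmerGroup hy k r hy'⟩ = r • θ k ⟨y, hy'⟩)
    (h164 : ∀ k, ∃ y ∈ ((S.t k).cond).selmerGroup,
      κ.one k = galoisCohomology.scalarMapH1 (S.T.ρ k) (S.T.hlin k)
        (S.π ^ (Module.length R (M k)).toNat) y)
    (hone : κ.one ≠ 0) :
    ∃ x : ∀ k, galoisCohomology (S.T.ρ k) 1,
      S.T.IsFreeRankOneOn (S.T.limitSelmer fun k => (S.t k).cond) x ∧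
      ∃ k₀ : ℕ, ∀ k, k₀ ≤ k → ∀ r₁ : R, κ.one = S.T.smulFamily r₁ x →
        Module.length R (M k) ≤ Module.length R (R ⧸ Ideal.span {r₁}) :=
  S.exists_isFreeRankOneOn_length_le_of_printedInputs κ hy (S.π_mem_maximalIdeal hy) (S.e_le_succ hy)
    (fun k _ hy' => S.incH1_mem_selmerGroup hy _ _ k hy')
    (fun k y _ h => S.incH1_injective hy _ _ k (by rw [h, map_zero])) c hM θ hθ h164 hone

end DVRSetting

end Literature.NumberTheory.GaloisCohomology.Howard2004

end
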